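import Literature.MathematicalPhysics.QuantumFieldTheory.Balaban1983to89.T4InputCauchyRateTermwise

/-!
# OutputRateTermwiseLoc — termwise majorants with PER-DOMAIN (localized) budgets `a k i X`: the class bound and the segment
# M-test are per-`X` arguments, so every termwise END face of route P1 holds with `TermBound κ a`/`TermBudget a G` (X-blind weights)
# replaced by `TermBoundLoc κ a`/`TermBudgetLoc a G` (weights indexed by the step-`k` domain); absolute term labels then carry a
# VOLUME-UNIFORM class constant `G` without any re-coding of labels
# (cell `pub-balaban`, T⁴ fan-out, `HOME/BINDER-OWNERS.md` row NE5, owner lineage t4-ne5-p1, gen 30, route P1; ruling R21)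

HONEST FRAMING (T4-DAG PAGE 1).  Rung (B)+1 on ONE finite four-torus of fixed physical size — NOT infinite volume, NOT a mass gap, NOT
the Clay problem; `FlowStep.BetaPertH`, (B), (B^μ) do not occur here.  NE5 (`T4OutputRate.NE5`) is NOT PRINTED and NOT PROVED (spine
0/9, unchanged).  Nothing of Bałaban's series is asserted; 0 cite tags.  Printed KIND of the shapes (quoted verbatim in the leaf
`T4InputCauchyRateTermwise` §2 and the lineage's loci sheet `b13-loci.md`): [II] = [Balaban1988RG2Cluster] p. 20/21 — the series (2.13)
defining `𝐄^{(k+1)}(X)` is estimated term by term, each factor `|H(Z)|` replaced by the activity bound (2.38), and the SUM OVER THE TERMS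
WITH `∪Zᵢ = X` gives (2.41) `|𝐄^{(k+1)}(X)| ≤ O(1)C₃ε₁exp(−(1−10δ)½Lκd_{k+1}(X))`: a budget PER DOMAIN `X`, uniform in `X` and in the volume.
HONEST DEPENDENCY (cell, verbatim): continuum YM on T⁴ ⇐ BetaPertH ∧ nine spine estimates (0/9 proved); BetaPertH ⇐ (D1) ∧ (D4) ∧
CAP+tail; G-an2-4 gates asym, D1 and NE2/3/4.

WHY (the swarm's typed design point «R9 × R18 JUNCTION», journal l.11124, leaf-02 lineage; owner ruling R21).  Every termwise END face in
the tree — `T4InputCauchyRateTermwise.ne5_at_of_stepModel_termwise_*`, `OutputRateOpHolomorphic.…biStructural…`,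
`OutputRateOpGaussianParam.…gaussianParam…`, `OutputRateGaussianParamBi{,End}.…gaussianParamBi…` — carries
`hbd : TermBound K T W κ a` and `hbud : TermBudget a G := ∀ k, Summable (a k) ∧ Σ' i, a k i ≤ G` with an `X`-BLIND weight
`a : ℕ → ι → ℝ`.  On the model of record with ABSOLUTE term labels (a label localizes at one domain of the torus) `Σ_i a k i` runs over
the labels at ALL step-`k` domains, so the only `G` available is VOLUME-EXTENSIVE (leaf-02's finding, journal l.5621); the remedy of
record so far (design ruling R9) re-codes labels RELATIVE to `X`, which does not compose with the (2.14) dictionary `TermGaussianParamBi`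
whose parameter TYPES `β k i` are indexed by the label (for a coded label the decoded label, hence the type, depends on `X`).  REMEDY
R2′ = THIS MODULE: the two places where the budget is consumed — the class bound (`classBound_of_termwise`) and the segment M-test
(`diffContOnCl_of_termwise_path`) — are arguments AT ONE FIXED `X`; so the whole chain goes through with weights `a k i X` and the
budget `∀ k X, C.scale X = k → Summable (a k · X) ∧ Σ' i, a k i X ≤ G`.  With absolute labels `a k i X := 0` unless `i` localizes at
`X`, and `G` is the per-domain constant of (2.41) — volume-uniform; the parameter types stay indexed by the label; no coding enters.

WHAT THIS MODULE IS (every END face concludes `T4OutputRate.NE5` LITERALLY; SAME smallness `ω + G·c/(1 − ρ₀) < θ′`, SAME constant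
`(G(δ + δ′)/(1 − ρ₀) + B)(θ′ − ω)/(θ′ − (ω + G·c/(1 − ρ₀)))` as the X-blind faces — only the MEANING of `G` improves):
* §1 shapes **`TermBoundLoc K T W κ a`**, **`TermBudgetLoc a G`** (`a : ℕ → ι → C.Dom → ℝ`) and the bridges `termBoundLoc_of_termBound`,
  `termBudgetLoc_of_termBudget` (the X-blind shapes are the constant-in-`X` case; the converse is unavailable — that is the point).
* §2 `classBound_of_termwiseLoc`, `diffContOnCl_of_termwiseLoc_path`, `opFibreEnvelopeCl_of_termwiseLoc_op`,
  `histFibreEnvelopeCl_of_termwiseLoc_hist` — the leaf's §4/§5 lemmas with the budget read at the fixed domain.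
* §3 END faces `ne5_at_of_stepModel_termwiseLoc_split_scale_nat` (species-separated line hypotheses), `…termwiseLoc_slack_scale_nat`
  (`TermLineAnalytic`), `…termwiseLoc_expLinear_scale_nat`, `…termwiseLoc_expLinear_budget_scale_nat` (ball class from `BaseBudget`).
* sibling module `OutputRateTermwiseLocStructural`: the structural producers of `TermBoundLoc` (dominated holomorphic integrals, ball
  form, parametrised Gaussians, the ONE (2.14)-shape `TermGaussianParamBi`) and the structural END faces with per-domain budgets, down to the
  most-reduced Cauchy face `ne5_at_of_stepModel_termwiseLoc_gaussianParamBi_mass_scale_nat`.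

STATUS (census, Edison rule).  Bookkeeping/[folklore]; discharges NO wall; changes NO census value except the READING of the class
constant `G` in W2/S (per-domain, volume-uniform, for absolute labels).  NE5 NOT PROVED; 0/12 leaves on Bałaban's concrete objects;
spine 0/9; rung (B)+1 finite T⁴; NOT infinite volume / mass gap / Clay.  0 sorry; axioms ⊆ {propext, Classical.choice, Quot.sound}.
-/

noncomputable section

open Set Metric MeasureTheory Filter

namespace Summit.QuantumFields.BalabanUV.T4Continuum.OutputRateTermwiseLoc

open Literature.MathematicalPhysics.QuantumFieldTheory.Balaban1983to89
open Literature.MathematicalPhysics.QuantumFieldTheory.Balaban1983to89.T4OutputRate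
open Literature.MathematicalPhysics.QuantumFieldTheory.Balaban1983to89.T4InputCauchyRate
open Literature.MathematicalPhysics.QuantumFieldTheory.Balaban1983to89.T4InputCauchyRateData
open Literature.MathematicalPhysics.QuantumFieldTheory.Balaban1983to89.T4InputCauchyRateSpecies
open Literature.MathematicalPhysics.QuantumFieldTheory.Balaban1983to89.T4InputCauchyRateTermwise

/-! ## §1 The per-domain shapes and the bridges from the X-blind ones -/

section Shapes

variable {C : Carriers} {Op Hist : Type*} {ι : Type*} (K : ℕ → (ℕ → ℝ) → C.BgB → Set (Op × Hist))
  (T : ℕ → ι → Op → Hist → C.Dom → ℂ)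

/-- HYPOTHESIS SHAPE `TermBoundLoc K T κ a` — `T4InputCauchyRateTermwise.TermBound` with the termwise weight ALLOWED TO DEPEND ON THE
STEP-`k` DOMAIN `X` (printed SUPPORT, same as `TermBound`: [II] p. 20/21, each factor `|H(Z)|` replaced by (2.38), term by term, the
decay factor extracted uniformly in `X`; NOT PRINTED as a statement over a class `K`): at every class point every term is dominated AT
`X` by its weight `a k i X` times `e^{−κd(X)}`.  With absolute labels the natural weight vanishes unless the label localizes at `X`.
[folklore] -/
def TermBoundLoc (W : Set (ℕ → ℝ)) (κ : ℝ) (a : ℕ → ι → C.Dom → ℝ) : Prop :=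
  ∀ k, ∀ g ∈ W, ∀ (U : C.BgB) (q : Op × Hist), q ∈ K k g U → ∀ X : C.Dom, C.scale X = k →
    ∀ i, ‖T k i q.1 q.2 X‖ ≤ a k i X * Real.exp (-(κ * C.d X))

/-- HYPOTHESIS SHAPE `TermBudgetLoc a G` — `T4InputCauchyRateTermwise.TermBudget` PER DOMAIN (printed SUPPORT: the summation to (2.41)
p. 21 of [II] is over the terms `(Z₁,…,Zₙ)` with `∪Zᵢ = X` — a sum AT FIXED `X`, its value `O(1)C₃ε₁` uniform in `X` and in the volume;
NOT PRINTED over a class): at every step-`k` domain `X` the weights `a k · X` are summable with sum at most `G`. [folklore] -/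
def TermBudgetLoc (a : ℕ → ι → C.Dom → ℝ) (G : ℝ) : Prop :=
  ∀ k (X : C.Dom), C.scale X = k → Summable (fun i => a k i X) ∧ ∑' i, a k i X ≤ G

variable {K T}

/-- BRIDGE: an X-blind `TermBound κ a` is a `TermBoundLoc κ (k i _ ↦ a k i)`. [folklore] -/
theorem termBoundLoc_of_termBound {W : Set (ℕ → ℝ)} {κ : ℝ} {a : ℕ → ι → ℝ} (h : TermBound K T W κ a) :
    TermBoundLoc K T W κ (fun k i _ => a k i) := fun k g hg U q hq X hX i => h k g hg U q hq X hX i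

/-- BRIDGE: an X-blind `TermBudget a G` is a `TermBudgetLoc (k i _ ↦ a k i) G` (at every domain the same weights). [folklore] -/
theorem termBudgetLoc_of_termBudget {a : ℕ → ι → ℝ} {G : ℝ} (h : TermBudget a G) :
    TermBudgetLoc (fun k i (_ : C.Dom) => a k i) G := fun k _ _ => h k

/-- The per-domain budget makes the weights' sum nonnegative-bounded: at a step-`k` domain, `0 ≤ G` as soon as the weights there are
nonnegative (bookkeeping used when sizing constants). [folklore] -/
theorem termBudgetLoc_nonneg {a : ℕ → ι → C.Dom → ℝ} {G : ℝ} (h : TermBudgetLoc a G) {k : ℕ} {X : C.Dom} (hX : C.scale X = k)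
    (ha : ∀ i, 0 ≤ a k i X) : 0 ≤ G :=
  (tsum_nonneg ha).trans (h k X hX).2

end Shapes

/-! ## §2 Class bound, segment M-test and the two weaker fibre envelopes — the budget read at the fixed domain -/

section Termwise

variable {C : Carriers} {Op Hist : Type*} [NormedAddCommGroup Op] [NormedSpace ℂ Op] [NormedAddCommGroup Hist]
  [NormedSpace ℂ Hist] {ι : Type*} {M : StepModel C Op Hist} {K : ℕ → (ℕ → ℝ) → C.BgB → Set (Op × Hist)}
  {T : ℕ → ι → Op → Hist → C.Dom → ℂ}

/-- **TERMWISE (PER-DOMAIN BUDGET) ⟹ CLASS BOUND**: `TermRep ∧ TermBoundLoc κ a ∧ TermBudgetLoc a G ⟹ ClassBound K κ G` — at the fixed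
domain `X` the norm of the convergent sum is at most `(Σ' i, a k i X)·e^{−κd(X)} ≤ G·e^{−κd(X)}`. [folklore] -/
theorem classBound_of_termwiseLoc {W : Set (ℕ → ℝ)} {κ G : ℝ} {a : ℕ → ι → C.Dom → ℝ} (hrep : TermRep M K T W)
    (hbd : TermBoundLoc K T W κ a) (hbud : TermBudgetLoc a G) : ClassBound M K W κ G := by
  intro k g hg U q hq X hX
  have h1 : ‖M.Out k q.1 q.2 X‖ ≤ (∑' i, a k i X) * Real.exp (-(κ * C.d X)) :=
    (hrep k g hg U q hq X hX).norm_le_of_bounded ((hbud k X hX).1.hasSum.mul_right _) (hbd k g hg U q hq X hX)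
  exact h1.trans (mul_le_mul_of_nonneg_right (hbud k X hX).2 (Real.exp_pos _).le)

/-- **TERMWISE (PER-DOMAIN BUDGET) ⟹ `DiffContOnCl` ALONG ANY PATH WHOSE TERMS ARE DISC-ANALYTIC** — the leaf's
`diffContOnCl_of_termwise_path` with the majorants `a k i X·e^{−κd(X)}` and their summability read AT the path's fixed domain `X`.
[folklore] -/
theorem diffContOnCl_of_termwiseLoc_path {W : Set (ℕ → ℝ)} {κ G : ℝ} {a : ℕ → ι → C.Dom → ℝ} (hrep : TermRep M K T W)
    (hbd : TermBoundLoc K T W κ a) (hbud : TermBudgetLoc a G) {k : ℕ} {g : ℕ → ℝ} (hg : g ∈ W) {U : C.BgB}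
    {γ : ℂ → Op × Hist} (hseg : ∀ ζ ∈ closedBall (0 : ℂ) 1, γ ζ ∈ K k g U) {X : C.Dom} (hX : C.scale X = k)
    (hT : ∀ i, DifferentiableOn ℂ (fun ζ : ℂ => T k i (γ ζ).1 (γ ζ).2 X) (closedBall 0 1)) :
    DiffContOnCl ℂ (fun ζ : ℂ => M.Out k (γ ζ).1 (γ ζ).2 X) (ball 0 1) := by
  have hle : ∀ i, ∀ ζ ∈ closedBall (0 : ℂ) 1, ‖T k i (γ ζ).1 (γ ζ).2 X‖ ≤ a k i X * Real.exp (-(κ * C.d X)) :=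
    fun i ζ hζ => hbd k g hg U _ (hseg ζ hζ) X hX i
  have heq : ∀ ζ ∈ closedBall (0 : ℂ) 1, ∑' i, T k i (γ ζ).1 (γ ζ).2 X = M.Out k (γ ζ).1 (γ ζ).2 X :=
    fun ζ hζ => (hrep k g hg U _ (hseg ζ hζ) X hX).tsum_eq
  refine ⟨?_, ?_⟩
  · have hsum := Complex.differentiableOn_tsum_of_summable_norm ((hbud k X hX).1.mul_right _)
      (fun i => (hT i).mono ball_subset_closedBall) isOpen_ball
      (fun i ζ hζ => hle i ζ (ball_subset_closedBall hζ))
    exact hsum.congr fun ζ hζ => (heq ζ (ball_subset_closedBall hζ)).symm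
  · rw [closure_ball (0 : ℂ) one_ne_zero]
    have hsum := continuousOn_tsum (fun i => (hT i).continuousOn) ((hbud k X hX).1.mul_right _) fun i ζ hζ => hle i ζ hζ
    exact hsum.congr fun ζ hζ => (heq ζ hζ).symm

/-- **TERMWISE (OPERATOR SPECIES, PER-DOMAIN BUDGET) + THE UNDILATED SLACK ⟹ THE WEAKER OPERATOR FIBRE ENVELOPE** `OpFibreEnvelopeCl κ G`.
[folklore] -/
theorem opFibreEnvelopeCl_of_termwiseLoc_op {W : Set (ℕ → ℝ)} {κ G : ℝ} {a : ℕ → ι → C.Dom → ℝ} (hbox : BoxInClass M K W)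
    (hrep : TermRep M K T W) (hbd : TermBoundLoc K T W κ a) (hbud : TermBudgetLoc a G) (hline : TermOpLineAnalytic K T W) :
    OpFibreEnvelopeCl M W κ G := by
  have hcb : ClassBound M K W κ G := classBound_of_termwiseLoc hrep hbd hbud
  intro k g hg U p hp X hX h hh u hu
  have hseg : ∀ ζ ∈ closedBall (0 : ℂ) 1, (p.1 + ζ • u, h) ∈ K k g U :=
    fun ζ hζ => hbox k g hg U p hp (opSegment_mem_box hh hu hζ)
  exact ⟨diffContOnCl_of_termwiseLoc_path (γ := fun ζ => (p.1 + ζ • u, h)) hrep hbd hbud hg hseg hX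
    (hline k g hg U p.1 u h hseg X hX), fun ζ hζ => hcb k g hg U _ (hseg ζ hζ) X hX⟩

/-- **TERMWISE (HISTORY SPECIES, PER-DOMAIN BUDGET) + THE UNDILATED SLACK ⟹ THE WEAKER HISTORY FIBRE ENVELOPE** `HistFibreEnvelopeCl κ G`
(the exponent-critical wall W2-hist: the SAME `G` enters the smallness S — now the per-domain constant). [folklore] -/
theorem histFibreEnvelopeCl_of_termwiseLoc_hist {W : Set (ℕ → ℝ)} {κ G : ℝ} {a : ℕ → ι → C.Dom → ℝ} (hbox : BoxInClass M K W)
    (hrep : TermRep M K T W) (hbd : TermBoundLoc K T W κ a) (hbud : TermBudgetLoc a G)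
    (hline : TermHistLineAnalytic K T W) : HistFibreEnvelopeCl M W κ G := by
  have hcb : ClassBound M K W κ G := classBound_of_termwiseLoc hrep hbd hbud
  intro k g hg U p hp X hX o ho v hv
  have hseg : ∀ ζ ∈ closedBall (0 : ℂ) 1, (o, p.2 + ζ • v) ∈ K k g U :=
    fun ζ hζ => hbox k g hg U p hp (histSegment_mem_box ho hv hζ)
  exact ⟨diffContOnCl_of_termwiseLoc_path (γ := fun ζ => (o, p.2 + ζ • v)) hrep hbd hbud hg hseg hX
    (hline k g hg U o p.2 v hseg X hX), fun ζ hζ => hcb k g hg U _ (hseg ζ hζ) X hX⟩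

end Termwise

/-! ## §3 END faces from termwise data with per-domain budgets -/

section End

variable {C : Carriers} {Op Hist : Type*} [NormedAddCommGroup Op] [NormedSpace ℂ Op] [NormedAddCommGroup Hist]
  [NormedSpace ℂ Hist] {ι : Type*} (M : StepModel C Op Hist) (K : ℕ → (ℕ → ℝ) → C.BgB → Set (Op × Hist))
  (T : ℕ → ι → Op → Hist → C.Dom → ℂ)

/-- **NE5 FROM TERMWISE DATA WITH PER-DOMAIN BUDGETS, SPECIES-SEPARATED LINE HYPOTHESES AND THE UNDILATED SLACK** — the leaf's
`ne5_at_of_stepModel_termwise_split_scale_nat` with `TermBound κ a`/`TermBudget a G` REPLACED by `TermBoundLoc κ a`/`TermBudgetLoc a G`;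
every other binder BY NAME (MI-R, slack `BoxInClass`, `TermRep`, `TermOpLineAnalytic`, `TermHistLineAnalytic`, one-run levels, W1, W4,
insertion structure, W3, R, S); SAME smallness `ω + G·c/(1 − ρ₀) < θ′`, SAME constant; conclusion `T4OutputRate.NE5` LITERALLY.  NOT a proof
of NE5 for Bałaban's step: no binder is instantiated on his objects here. [folklore] -/
theorem ne5_at_of_stepModel_termwiseLoc_split_scale_nat {EA : Functional C C.BgA} {EB : Functional C C.BgB}
    {W : Set (ℕ → ℝ)} {a : ℕ → ι → C.Dom → ℝ} {κ G EA₀ E₀ E₁ δ δ' θ θ' c ω ρ₀ B : ℝ} {k₀ : ℕ}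
    (hrA : M.RepresentsA EA W) (hrB : M.RepresentsB EB W) (hbase : M.InBase EB W) (hbox : BoxInClass M K W)
    (hrep : TermRep M K T W) (hbd : TermBoundLoc K T W κ a) (hbud : TermBudgetLoc a G) (hlineOp : TermOpLineAnalytic K T W)
    (hlineHist : TermHistLineAnalytic K T W) (hdA : DecayBound EA W EA₀ κ) (hdB : DecayBound EB W E₀ κ)
    (hop : M.OperatorRate W δ θ) (hins : M.InsertionRate W κ E₀ δ' θ) (haff : M.InsAffine W) (hblind : M.InsBlind W)
    (hhom : M.InsHomog W) (hunit : M.InsScaleBound W κ E₁ c ω) (hE₁ : 0 < E₁) (hG : 0 ≤ G) (hδ : 0 ≤ δ)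
    (hδ' : 0 ≤ δ') (hθ : 0 ≤ θ) (hθθ' : θ ≤ θ') (hθ'1 : θ' ≤ 1) (hc : 0 ≤ c) (hω : 0 < ω) (hρ₀ : ρ₀ < 1)
    (hnear : (δ + δ') * θ ^ k₀ + c * (EA₀ + E₀) / (1 - ω) ≤ ρ₀) (hB : 0 ≤ B) (hfirst : ∀ k < k₀, EA₀ + E₀ ≤ B * θ ^ k)
    (hsmall : ω + G / (1 - ρ₀) * c < θ') :
    NE5 EA EB W κ θ' ((G / (1 - ρ₀) * δ + G / (1 - ρ₀) * δ' + B) * (θ' - ω) / (θ' - (ω + G / (1 - ρ₀) * c))) :=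
  ne5_at_of_stepModel_fibreCl₂_scale_nat hrA hrB hbase (opFibreEnvelopeCl_of_termwiseLoc_op hbox hrep hbd hbud hlineOp)
    (histFibreEnvelopeCl_of_termwiseLoc_hist hbox hrep hbd hbud hlineHist) hdA hdB hop hins haff hblind hhom hunit hE₁ hG hG
    hδ hδ' hθ hθθ' hθ'1 hc hω hρ₀ hnear hB hfirst hsmall

/-- **NE5 FROM TERMWISE DATA WITH PER-DOMAIN BUDGETS AND THE UNDILATED SLACK** (both species moved at once by `TermLineAnalytic`) —
the leaf's `ne5_at_of_stepModel_termwise_slack_scale_nat` with per-domain weights; SAME smallness, SAME constant. [folklore] -/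
theorem ne5_at_of_stepModel_termwiseLoc_slack_scale_nat {EA : Functional C C.BgA} {EB : Functional C C.BgB}
    {W : Set (ℕ → ℝ)} {a : ℕ → ι → C.Dom → ℝ} {κ G EA₀ E₀ E₁ δ δ' θ θ' c ω ρ₀ B : ℝ} {k₀ : ℕ}
    (hrA : M.RepresentsA EA W) (hrB : M.RepresentsB EB W) (hbase : M.InBase EB W) (hbox : BoxInClass M K W)
    (hrep : TermRep M K T W) (hbd : TermBoundLoc K T W κ a) (hbud : TermBudgetLoc a G) (hline : TermLineAnalytic K T W)
    (hdA : DecayBound EA W EA₀ κ) (hdB : DecayBound EB W E₀ κ) (hop : M.OperatorRate W δ θ)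
    (hins : M.InsertionRate W κ E₀ δ' θ) (haff : M.InsAffine W) (hblind : M.InsBlind W) (hhom : M.InsHomog W)
    (hunit : M.InsScaleBound W κ E₁ c ω) (hE₁ : 0 < E₁) (hG : 0 ≤ G) (hδ : 0 ≤ δ) (hδ' : 0 ≤ δ') (hθ : 0 ≤ θ)
    (hθθ' : θ ≤ θ') (hθ'1 : θ' ≤ 1) (hc : 0 ≤ c) (hω : 0 < ω) (hρ₀ : ρ₀ < 1)
    (hnear : (δ + δ') * θ ^ k₀ + c * (EA₀ + E₀) / (1 - ω) ≤ ρ₀) (hB : 0 ≤ B) (hfirst : ∀ k < k₀, EA₀ + E₀ ≤ B * θ ^ k)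
    (hsmall : ω + G / (1 - ρ₀) * c < θ') :
    NE5 EA EB W κ θ' ((G / (1 - ρ₀) * δ + G / (1 - ρ₀) * δ' + B) * (θ' - ω) / (θ' - (ω + G / (1 - ρ₀) * c))) :=
  ne5_at_of_stepModel_termwiseLoc_split_scale_nat M K T hrA hrB hbase hbox hrep hbd hbud
    (termOpLineAnalytic_of_termLineAnalytic hline) (termHistLineAnalytic_of_termLineAnalytic hline) hdA hdB hop hins haff
    hblind hhom hunit hE₁ hG hδ hδ' hθ hθθ' hθ'1 hc hω hρ₀ hnear hB hfirst hsmall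

/-- **NE5 FROM TERMWISE DATA WITH PER-DOMAIN BUDGETS AND EXP-LINEAR HISTORY TERMS** — the leaf's
`ne5_at_of_stepModel_termwise_expLinear_scale_nat` with per-domain weights: operator species `TermOpLineAnalytic` ([analysis]), history
species STRUCTURAL `TermHistExpLinear μ Φ Λ`; SAME smallness, SAME constant; conclusion `T4OutputRate.NE5` LITERALLY. [folklore] -/
theorem ne5_at_of_stepModel_termwiseLoc_expLinear_scale_nat {EA : Functional C C.BgA} {EB : Functional C C.BgB}
    {W : Set (ℕ → ℝ)} {a : ℕ → ι → C.Dom → ℝ} {α : ℕ → ι → Type*} [∀ k i, MeasurableSpace (α k i)]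
    {μ : ∀ k i, Op → C.Dom → Measure (α k i)} {Φ : ∀ k i, Op → C.Dom → α k i → ℂ}
    {Λ : ∀ k i, Op → C.Dom → α k i → (Hist →L[ℂ] ℂ)} {κ G EA₀ E₀ E₁ δ δ' θ θ' c ω ρ₀ B : ℝ} {k₀ : ℕ}
    (hrA : M.RepresentsA EA W) (hrB : M.RepresentsB EB W) (hbase : M.InBase EB W) (hbox : BoxInClass M K W)
    (hrep : TermRep M K T W) (hbd : TermBoundLoc K T W κ a) (hbud : TermBudgetLoc a G)
    (hlineOp : TermOpLineAnalytic K T W) (hexp : TermHistExpLinear K T W μ Φ Λ) (hdA : DecayBound EA W EA₀ κ)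
    (hdB : DecayBound EB W E₀ κ) (hop : M.OperatorRate W δ θ) (hins : M.InsertionRate W κ E₀ δ' θ)
    (haff : M.InsAffine W) (hblind : M.InsBlind W) (hhom : M.InsHomog W) (hunit : M.InsScaleBound W κ E₁ c ω)
    (hE₁ : 0 < E₁) (hG : 0 ≤ G) (hδ : 0 ≤ δ) (hδ' : 0 ≤ δ') (hθ : 0 ≤ θ) (hθθ' : θ ≤ θ') (hθ'1 : θ' ≤ 1) (hc : 0 ≤ c)
    (hω : 0 < ω) (hρ₀ : ρ₀ < 1) (hnear : (δ + δ') * θ ^ k₀ + c * (EA₀ + E₀) / (1 - ω) ≤ ρ₀) (hB : 0 ≤ B)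
    (hfirst : ∀ k < k₀, EA₀ + E₀ ≤ B * θ ^ k) (hsmall : ω + G / (1 - ρ₀) * c < θ') :
    NE5 EA EB W κ θ' ((G / (1 - ρ₀) * δ + G / (1 - ρ₀) * δ' + B) * (θ' - ω) / (θ' - (ω + G / (1 - ρ₀) * c))) :=
  ne5_at_of_stepModel_termwiseLoc_split_scale_nat M K T hrA hrB hbase hbox hrep hbd hbud hlineOp
    (termHistLineAnalytic_of_expLinear hexp) hdA hdB hop hins haff hblind hhom hunit hE₁ hG hδ hδ' hθ hθθ' hθ'1 hc hω
    hρ₀ hnear hB hfirst hsmall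

/-- **NE5 FROM BUDGET, TERMWISE DATA WITH PER-DOMAIN BUDGETS AND EXP-LINEAR HISTORY TERMS ON THE UNDILATED BALL CLASS** — the leaf's
`ne5_at_of_stepModel_termwise_expLinear_budget_scale_nat` with per-domain weights (`BaseBudget ctr BOp BHist`, PLAIN room
`BOp + rOp ≤ ROp`, `BHist + rHist ≤ RHist`, termwise data on `ballClass ctr ROp RHist`); SAME smallness, SAME constant. [folklore] -/
theorem ne5_at_of_stepModel_termwiseLoc_expLinear_budget_scale_nat {EA : Functional C C.BgA} {EB : Functional C C.BgB}
    {W : Set (ℕ → ℝ)} {ctr : ℕ → (ℕ → ℝ) → C.BgB → Op × Hist} {BOp BHist ROp RHist : ℕ → ℝ} {a : ℕ → ι → C.Dom → ℝ}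
    {α : ℕ → ι → Type*} [∀ k i, MeasurableSpace (α k i)] {μ : ∀ k i, Op → C.Dom → Measure (α k i)}
    {Φ : ∀ k i, Op → C.Dom → α k i → ℂ} {Λ : ∀ k i, Op → C.Dom → α k i → (Hist →L[ℂ] ℂ)}
    {κ G EA₀ E₀ E₁ δ δ' θ θ' c ω ρ₀ B : ℝ} {k₀ : ℕ} (hrA : M.RepresentsA EA W) (hrB : M.RepresentsB EB W)
    (hbase : M.InBase EB W) (hbudget : BaseBudget M W ctr BOp BHist) (hOp : ∀ k, BOp k + M.rOp k ≤ ROp k)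
    (hHist : ∀ k, BHist k + M.rHist k ≤ RHist k) (hrep : TermRep M (ballClass ctr ROp RHist) T W)
    (hbd : TermBoundLoc (ballClass ctr ROp RHist) T W κ a) (hbud : TermBudgetLoc a G)
    (hlineOp : TermOpLineAnalytic (ballClass ctr ROp RHist) T W)
    (hexp : TermHistExpLinear (ballClass ctr ROp RHist) T W μ Φ Λ) (hdA : DecayBound EA W EA₀ κ)
    (hdB : DecayBound EB W E₀ κ) (hop : M.OperatorRate W δ θ) (hins : M.InsertionRate W κ E₀ δ' θ)
    (haff : M.InsAffine W) (hblind : M.InsBlind W) (hhom : M.InsHomog W) (hunit : M.InsScaleBound W κ E₁ c ω)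
    (hE₁ : 0 < E₁) (hG : 0 ≤ G) (hδ : 0 ≤ δ) (hδ' : 0 ≤ δ') (hθ : 0 ≤ θ) (hθθ' : θ ≤ θ') (hθ'1 : θ' ≤ 1) (hc : 0 ≤ c)
    (hω : 0 < ω) (hρ₀ : ρ₀ < 1) (hnear : (δ + δ') * θ ^ k₀ + c * (EA₀ + E₀) / (1 - ω) ≤ ρ₀) (hB : 0 ≤ B)
    (hfirst : ∀ k < k₀, EA₀ + E₀ ≤ B * θ ^ k) (hsmall : ω + G / (1 - ρ₀) * c < θ') :
    NE5 EA EB W κ θ' ((G / (1 - ρ₀) * δ + G / (1 - ρ₀) * δ' + B) * (θ' - ω) / (θ' - (ω + G / (1 - ρ₀) * c))) :=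
  ne5_at_of_stepModel_termwiseLoc_expLinear_scale_nat M (ballClass ctr ROp RHist) T hrA hrB hbase
    (boxInClass_of_baseBudget hbudget hOp hHist) hrep hbd hbud hlineOp hexp hdA hdB hop hins haff hblind hhom hunit hE₁
    hG hδ hδ' hθ hθθ' hθ'1 hc hω hρ₀ hnear hB hfirst hsmall

end End

end Summit.QuantumFields.BalabanUV.T4Continuum.OutputRateTermwiseLoc

end
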